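import Summits.CriticalPhenomena.CardyFormulaZ2.Theorems.CardyFlipRussoCoveringLegRobustDefs
import Summits.CriticalPhenomena.CardyFormulaZ2.Theses.CardyMagicRigidity
import Literature.Probability.Percolation.CardyFormulaConformalInvariance
import Literature.Probability.Percolation.BoxCrossingUpperBound
import Literature.Probability.Percolation.ZdNearCriticalWindow
import Literature.Probability.Percolation.HalfSpacePinnedPairs
import Literature.Probability.Percolation.SharpnessDCTProofs
import Literature.Probability.RandomPlanarGeometry.ConformalRectangleProofs
import Literature.Probability.RandomPlanarGeometry.CollarDomain
import Literature.Probability.RandomPlanarGeometry.PlanarDomainsTopology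
import Literature.Probability.RandomPlanarGeometry.ProfileCollar
import Literature.Probability.RandomPlanarGeometry.ProfileCollarSandwich
import Literature.Probability.RandomPlanarGeometry.ConformalRectangleShift
import Literature.Topology.PlaneTopology.Crosscut
import HarnessLib

/-!
# Stub `stub_comparisonGeometryStrong` of line `five-arm-null` (v5): comparison quads in sandwich
position, with the all-points lateral margin

Crux `stmt-CriticalPhenomena-6435` (`CardyFlipRusso.CoveringLeg`), line five-arm-null, skeleton v5,
stub `Sig.stub_comparisonGeometryStrong` (`CardyFlipRussoCoveringLegRobustDefs.lean`): for a conformal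
rectangle `R = (Ω; P₀, …, P₃)` and a closeness budget `ε₀ > 0` we build, for every plate margin
`t > 0`, the LOWER comparison quad `Q` (poking out of `Ω` across the arcs `0, 2`, pushed into `Ω`
along the arcs `1, 3`) and the UPPER comparison quad `N` (the same with respect to the arcs `1, 3`,
for the cyclically re-marked rectangle), with rooms `r > 0`, in sandwich position. This is the
tree's `LoopsToCrossings.OracleSandwich.stub_comparisonGeometry`
(`CardyMagicRigidityLoopsToCrossingsStubComparisonGeometry.lean`) with the lateral margin clause
STRENGTHENED from the points of the fattened quad inside `Ω` to ALL its points: every point of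
`cthickening r Q.carrier` is `m`-far from the banned arcs `1, 3` of `R` (resp. `0, 2` for `N`), also
outside `Ω` near the corners.

Construction (Bollobás–Riordan, *Percolation* (2006), Ch. 7 Lemma 14 p. 184 and Fig. 14 p. 186,
repaired at the corners), verbatim from the tree file: the boundary loop of `Q` is the profile loop
`u ↦ T.tube (p u) u` (`ProfileCollar.lean`) of a two-plateau trapezoid profile
(`exists_trapezoid_profile`), high plateau `1 + θ` over the re-marked arcs `0, 2` of `Q`, low
plateau `1 - h` along the arcs `1, 3` of `R`, all level-`1` crossings interior to the arcs `0, 2`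
of `R`; the clause checks are `sandwich_of_frontier_eq` / `cap_of_subset_image` of
`ProfileCollarSandwich.lean`. The only new point is the margin for the points of the fattened quad
OFF `Ω`: such a point is `2 r`-close to a point `x` of `Q`; if `x ∈ Ω` the tree's inside clause
applies to `x`, and if `x ∉ Ω` then `x = T.tube s u` is an exterior tube point on a pushed-out ray
(`exists_eq_tube_of_mem_of_not_mem'`), whose boundary point `∂Ω(u)` lies on the inner part of an
allowed arc, `d₀`-far from the banned arcs, while `dist x ∂Ω(u) < d₀ / 4`. The room is taken with
`8 r ≤ min mi (d₀ / 2)` and the exported margin is `min mi (d₀ / 2) / 4`. The upper quad is the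
lower quad of the re-marked rectangle `(Ω; P₁, P₂, P₃, P₀)` (`MarkedDomain.exists_shiftMarks`).
-/

noncomputable section

namespace Summit.CriticalPhenomena.CardyFormulaZ2.Cruxes.CoveringLeg.FiveArmNull

open Literature.Probability.RandomPlanarGeometry hiding cardyFunction
open Literature.Probability.Percolation hiding cardyFunction
open Literature.Probability.LatticeModels
open Filter Topology Set MeasureTheory Metric

/-- **The lower comparison quad of a conformal rectangle, all-points margin** (all position
clauses of the stub, for the arcs `0, 2` allowed and `1, 3` banned), by the trapezoid profile
collar: as `OracleSandwich.exists_lowerQuad`, but EVERY point of the `r`-fattening of `Q` (not only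
those in `Ω`) is `m`-far from the arcs `1, 3` of `R`. The lateral margin `m` depends on `ε₀` only.
[cite: BollobasRiordan2006, Ch. 7 Lemma 14 p. 184 and p. 186 (Fig. 14)] -/
theorem quadsStrong_exists_lowerQuad (R : ConformalRectangle) {ε₀ : ℝ} (hε₀ : 0 < ε₀) :
    ∃ m : ℝ, 0 < m ∧ ∀ t : ℝ, 0 < t →
    ∃ (Q : ConformalRectangle) (r : ℝ), 0 < r ∧
      (∀ u : ℝ, dist (Q.boundary u) (R.boundary u) ≤ ε₀) ∧
      (∀ i : Fin 4, |Q.mark i - R.mark i| ≤ ε₀) ∧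
      (∀ z ∈ cthickening r Q.carrier, z ∉ R.carrier → infDist z (R.arc 0) ≤ t ∨ infDist z (R.arc 2) ≤ t) ∧
      (∀ z ∈ cthickening r Q.carrier, m ≤ infDist z (R.arc 1) ∧ m ≤ infDist z (R.arc 3)) ∧
      (∀ z ∈ cthickening r (Q.arc 0), z ∉ R.carrier ∧ infDist z (R.arc 0) ≤ t) ∧
      (∀ z ∈ cthickening r (Q.arc 2), z ∉ R.carrier ∧ infDist z (R.arc 2) ≤ t) := by
  obtain ⟨h0, h1, h2, h3, h4⟩ := R.marks_chain
  obtain ⟨n0, -, n2, -⟩ := R.nextMarks_eq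
  have hm1 := (R.mark_mem 1).2; have hm3 := (R.mark_mem 3).2
  obtain ⟨T⟩ := R.toJordanDomain.nonempty_tubeData
  -- the room `s` (from `ε₀` and the mark gaps)
  obtain ⟨s, hs0, hsε, hs1, hs2, hs3, hs4⟩ : ∃ s : ℝ, 0 < s ∧ s ≤ ε₀ ∧ 4 * s ≤ R.mark 1 - R.mark 0 ∧
      4 * s ≤ R.mark 2 - R.mark 1 ∧ 4 * s ≤ R.mark 3 - R.mark 2 ∧ 4 * s ≤ R.mark 0 + 1 - R.mark 3 := by
    refine ⟨min ε₀ (min (min (R.mark 1 - R.mark 0) (R.mark 2 - R.mark 1)) (min (R.mark 3 - R.mark 2) (R.mark 0 + 1 - R.mark 3)) / 4),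
      lt_min hε₀ (by
        refine div_pos (lt_min (lt_min ?_ ?_) (lt_min ?_ ?_)) four_pos <;> linarith), min_le_left _ _, ?_, ?_, ?_, ?_⟩ <;>
    · have := min_le_right ε₀ (min (min (R.mark 1 - R.mark 0) (R.mark 2 - R.mark 1)) (min (R.mark 3 - R.mark 2) (R.mark 0 + 1 - R.mark 3)) / 4)
      have a1 := min_le_left (min (R.mark 1 - R.mark 0) (R.mark 2 - R.mark 1)) (min (R.mark 3 - R.mark 2) (R.mark 0 + 1 - R.mark 3))
      have a2 := min_le_right (min (R.mark 1 - R.mark 0) (R.mark 2 - R.mark 1)) (min (R.mark 3 - R.mark 2) (R.mark 0 + 1 - R.mark 3))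
      have b1 := min_le_left (R.mark 1 - R.mark 0) (R.mark 2 - R.mark 1)
      have b2 := min_le_right (R.mark 1 - R.mark 0) (R.mark 2 - R.mark 1)
      have b3 := min_le_left (R.mark 3 - R.mark 2) (R.mark 0 + 1 - R.mark 3)
      have b4 := min_le_right (R.mark 3 - R.mark 2) (R.mark 0 + 1 - R.mark 3)
      linarith
  -- separation of the non-low boundary points from the banned arcs (from `s`)
  obtain ⟨d₀, hd₀, hsep⟩ := R.exists_sep_arcs (κ := s / 8) (by linarith)
  -- the width `h` (from `ε₀`, the depth of the centre and `d₀`)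
  have hρ₀ := R.toJordanDomain.infDist_frontier_pos T.hz₀
  obtain ⟨h, hh, hh1, htol⟩ := T.exists_dist_tube_lt (ε := min (min ε₀ (infDist T.z₀ (frontier R.carrier))) (d₀ / 4))
    (lt_min (lt_min hε₀ hρ₀) (by linarith))
  have htol1 : ∀ σ u, 1 - h ≤ σ → σ ≤ 1 + h → dist (T.tube σ u) (R.boundary u) < ε₀ := fun σ u ha hb =>
    (htol σ u ha hb).trans_le ((min_le_left _ _).trans (min_le_left _ _))
  have htol2 : ∀ σ u, 1 - h ≤ σ → σ ≤ 1 + h → dist (T.tube σ u) (R.boundary u) < infDist T.z₀ (frontier R.carrier) :=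
    fun σ u ha hb => (htol σ u ha hb).trans_le ((min_le_left _ _).trans (min_le_right _ _))
  have htol3 : ∀ σ u, 1 - h ≤ σ → σ ≤ 1 + h → dist (T.tube σ u) (R.boundary u) < d₀ / 4 := fun σ u ha hb =>
    (htol σ u ha hb).trans_le (min_le_right _ _)
  -- the depth of the inner levels (from `h`), and the lateral margin
  obtain ⟨mi, hmi, hdeep⟩ := T.exists_le_infDist_tube_inner (h := h / 2) (by linarith) (by linarith)
  refine ⟨min mi (d₀ / 2) / 4, by positivity, fun t ht => ?_⟩
  -- per `t`: the poke-out `θ`, the outer margin, the profile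
  obtain ⟨θ₁, hθ₁, hθ₁1, htolθ⟩ := T.exists_dist_tube_lt (ε := t / 2) (by linarith)
  obtain ⟨θ, hθ0, hθh, hθθ₁⟩ : ∃ θ : ℝ, 0 < θ ∧ θ ≤ h ∧ θ ≤ θ₁ := ⟨min θ₁ h, lt_min hθ₁ hh, min_le_right _ _, min_le_left _ _⟩
  obtain ⟨mo, hmo, hout⟩ := T.exists_le_infDist_tube_outer (h := θ) hθ0 (by linarith)
  obtain ⟨p, hpc, hper, hband, hplat, hloc⟩ := exists_trapezoid_profile (a₀ := R.mark 0) (a₁ := R.mark 1)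
    (a₂ := R.mark 2) (a₃ := R.mark 3) (s := s) (h := h) (θ := θ) (by linarith) h2.le (by linarith) h4.le hs0 hh hθ0 hθh
  have hp0 : ∀ u, 0 < p u := fun u => by linarith [(hband u).1]
  have hp2 : ∀ u, p u < 2 := fun u => by linarith [(hband u).2]
  -- the quad
  let Q : ConformalRectangle :=
    { toJordanDomain := JordanDomain.ofLoop (T.continuous_profileLoop hpc hp0 hp2) (T.periodic_profileLoop hper)
        (T.injOn_profileLoop hp0 hp2)
      mark := ![R.mark 0 + s, R.mark 1 - s, R.mark 2 + s, R.mark 3 - s]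
      strictMono_mark := Fin.strictMono_iff_lt_succ.2 fun k => by
        fin_cases k
        · show R.mark 0 + s < R.mark 1 - s; linarith
        · show R.mark 1 - s < R.mark 2 + s; linarith
        · show R.mark 2 + s < R.mark 3 - s; linarith
      mark_mem := fun k => by
        fin_cases k
        · show R.mark 0 + s ∈ Ico 0 1; exact ⟨by linarith, by linarith⟩
        · show R.mark 1 - s ∈ Ico 0 1; exact ⟨by linarith, by linarith⟩
        · show R.mark 2 + s ∈ Ico 0 1; exact ⟨by linarith, by linarith⟩
        · show R.mark 3 - s ∈ Ico 0 1; exact ⟨by linarith, by linarith⟩ }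
  have hQf : frontier Q.carrier = range fun u => T.tube (p u) u := JordanDomain.frontier_ofLoop_carrier _ _ _
  obtain ⟨nQ0, -, nQ2, -⟩ := Q.nextMarks_eq
  -- the centre is inside
  have hz₀ : T.z₀ ∈ Q.carrier := T.z₀_mem_of_frontier_eq hpc hper hp0 hp2 Q.toJordanDomain hQf fun u =>
    htol2 _ _ (hband u).1 (by linarith [(hband u).2])
  -- localisation of the non-low boundary points
  set I : Set ℝ := Icc (R.mark 0 + s / 8) (R.mark 1 - s / 8) ∪ Icc (R.mark 2 + s / 8) (R.mark 3 - s / 8) with hI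
  have hbf : ∀ u, R.boundary (R.mark 0 + Int.fract (u - R.mark 0)) = R.boundary u := fun u => by
    have := R.periodic_boundary.sub_int_mul_eq (x := u) ⌊u - R.mark 0⌋
    rw [mul_one] at this
    rw [← this, Int.fract]; congr 1; ring
  have hK : ∀ u, 1 - h / 2 < p u → R.boundary u ∈ R.boundary '' I := fun u hu => by
    rw [← hbf u]
    refine ⟨_, ?_, rfl⟩
    rcases hloc u hu with ⟨ha, hb⟩ | ⟨ha, hb⟩
    · exact Or.inl ⟨ha.le, hb.le⟩
    · exact Or.inr ⟨ha.le, hb.le⟩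
  have hKA : R.boundary '' I ⊆ R.arc 0 ∪ R.arc 2 := by
    rintro _ ⟨u, hu, rfl⟩
    rcases hu with ⟨ha, hb⟩ | ⟨ha, hb⟩
    · exact Or.inl ⟨u, ⟨by linarith, by rw [n0]; linarith⟩, rfl⟩
    · exact Or.inr ⟨u, ⟨by linarith, by rw [n2]; linarith⟩, rfl⟩
  have hKB : ∀ k ∈ R.boundary '' I, ∀ b ∈ R.arc 1 ∪ R.arc 3, d₀ ≤ dist k b := by
    rintro _ ⟨u, hu, rfl⟩ b hb
    exact hsep u hu b hb
  have hAB : frontier R.carrier ⊆ (R.arc 0 ∪ R.arc 2) ∪ (R.arc 1 ∪ R.arc 3) := by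
    intro x hx
    rw [← (R.iUnion_arc_holds : ⋃ i, R.arc i = frontier R.carrier), mem_iUnion] at hx
    obtain ⟨i, hi⟩ := hx
    fin_cases i
    · exact Or.inl (Or.inl hi)
    · exact Or.inr (Or.inl hi)
    · exact Or.inl (Or.inr hi)
    · exact Or.inr (Or.inr hi)
  have hB : R.arc 1 ∪ R.arc 3 ⊆ frontier R.carrier := union_subset (R.arc_subset_frontier 1) (R.arc_subset_frontier 3)
  -- the room `r` (twice smaller than in the tree file, for the all-points margin)
  obtain ⟨r, hr, hrt, hrmo, hrM⟩ : ∃ r : ℝ, 0 < r ∧ 8 * r ≤ t ∧ 4 * r ≤ mo ∧ 8 * r ≤ min mi (d₀ / 2) :=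
    ⟨min (t / 8) (min (mo / 4) (min mi (d₀ / 2) / 8)), by positivity,
      by linarith [min_le_left (t / 8) (min (mo / 4) (min mi (d₀ / 2) / 8))],
      by linarith [min_le_right (t / 8) (min (mo / 4) (min mi (d₀ / 2) / 8)), min_le_left (mo / 4) (min mi (d₀ / 2) / 8)],
      by linarith [min_le_right (t / 8) (min (mo / 4) (min mi (d₀ / 2) / 8)), min_le_right (mo / 4) (min mi (d₀ / 2) / 8)]⟩
  have hMmi : min mi (d₀ / 2) ≤ mi := min_le_left _ _
  have hMd : min mi (d₀ / 2) ≤ d₀ / 2 := min_le_right _ _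
  -- the sandwich clauses
  obtain ⟨hout_cl, hin_cl⟩ := T.sandwich_of_frontier_eq hper hp0 hp2 Q.toJordanDomain hQf
    (A := R.arc 0 ∪ R.arc 2) (B := R.arc 1 ∪ R.arc 3) (K := R.boundary '' I)
    (h' := h / 2) (θ := θ) (tol := d₀ / 4) (tolθ := t / 2) (d₀ := d₀) (mi := mi) (r := r)
    hθ0.le (by linarith) (fun u => (hband u).2) hK hKA hKB hAB hB
    (fun σ u ha hb => hdeep σ u (abs_le.2 ⟨by linarith, hb⟩))
    (fun σ u ha hb => htol3 σ u (by linarith) (by linarith))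
    (fun σ u ha hb => htolθ σ u (by linarith) (by linarith)) hr (by linarith) (by linarith)
  -- the cap clauses
  have hcap : ∀ (I₀ : Set ℝ) (A₀ C : Set ℂ), (∀ u ∈ I₀, R.boundary u ∈ A₀) → C ⊆ (fun u => T.tube (1 + θ) u) '' I₀ →
      ∀ z ∈ cthickening r C, z ∉ R.carrier ∧ infDist z A₀ ≤ t := fun I₀ A₀ C hI₀ hC z hz => by
    obtain ⟨hzΩ, a, ha, hza⟩ := T.cap_of_subset_image (θ' := θ) (mo := mo) (tolθ := t / 2) (r := r)
      (fun u => hout _ u le_rfl (by linarith)) (fun u => htolθ _ u (by linarith) (by linarith)) hI₀ hC hr (by linarith) z hz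
    exact ⟨hzΩ, (infDist_le_dist_of_mem ha).trans (by linarith)⟩
  refine ⟨Q, r, hr, fun u => (htol1 _ _ (hband u).1 (by linarith [(hband u).2])).le, fun i => ?_,
    fun z hz hzΩ => ?_, fun z hz => ?_, ?_, ?_⟩
  · -- marks
    fin_cases i
    · show |R.mark 0 + s - R.mark 0| ≤ ε₀; rw [add_sub_cancel_left, abs_of_pos hs0]; exact hsε
    · show |R.mark 1 - s - R.mark 1| ≤ ε₀; rw [sub_sub_cancel_left, abs_neg, abs_of_pos hs0]; exact hsε
    · show |R.mark 2 + s - R.mark 2| ≤ ε₀; rw [add_sub_cancel_left, abs_of_pos hs0]; exact hsε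
    · show |R.mark 3 - s - R.mark 3| ≤ ε₀; rw [sub_sub_cancel_left, abs_neg, abs_of_pos hs0]; exact hsε
  · -- off `Ω`: near an allowed arc
    obtain ⟨a, ha, hza⟩ := hout_cl z hz hzΩ
    rcases ha with ha | ha
    · exact Or.inl ((infDist_le_dist_of_mem ha).trans (by linarith))
    · exact Or.inr ((infDist_le_dist_of_mem ha).trans (by linarith))
  · -- ALL points of the fattened quad: off the banned arcs
    obtain ⟨x, hx, hzx⟩ := exists_dist_le_two_mul_of_mem_cthickening hr hz
    have key : ∀ b ∈ R.arc 1 ∪ R.arc 3, min mi (d₀ / 2) / 4 ≤ dist z b := by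
      intro b hb
      by_cases hxΩ : x ∈ R.carrier
      · -- `x ∈ Ω`: the inside clause of the tree at `x`
        have k1 := hin_cl x (self_subset_cthickening _ hx) hxΩ b hb
        have k2 := min_le_min (le_refl mi) (show d₀ / 2 ≤ d₀ - d₀ / 4 by linarith)
        linarith [dist_triangle x z b, dist_comm x z]
      · -- `x ∉ Ω`: an exterior tube point on a pushed-out ray, over the inner part of an allowed arc
        obtain ⟨σ, u, hσ1, hσp, rfl⟩ := T.exists_eq_tube_of_mem_of_not_mem' hper hp0 hp2 Q.toJordanDomain hQf hx hxΩ
        have k1 := hKB _ (hK u (by linarith)) b hb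
        have k2 := htol3 σ u (by linarith) (by linarith [(hband u).2])
        linarith [dist_triangle4 (R.boundary u) (T.tube σ u) z b, dist_comm (R.boundary u) (T.tube σ u),
          dist_comm (T.tube σ u) z]
    exact ⟨(le_infDist ⟨R.pt 1, R.pt_mem_arc_self 1⟩).2 fun b hb => key b (Or.inl hb),
      (le_infDist ⟨R.pt 3, R.pt_mem_arc_self 3⟩).2 fun b hb => key b (Or.inr hb)⟩
  · -- the cap over arc `0`
    refine hcap (Icc (R.mark 0 + s) (R.mark 1 - s)) (R.arc 0) (Q.arc 0)
      (fun u hu => ⟨u, ⟨by linarith [hu.1], by rw [n0]; linarith [hu.2]⟩, rfl⟩) ?_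
    rintro _ ⟨u, hu, rfl⟩
    rw [nQ0] at hu
    change u ∈ Icc (R.mark 0 + s) (R.mark 1 - s) at hu
    refine ⟨u, hu, ?_⟩
    show T.tube (1 + θ) u = T.tube (p u) u
    rw [hplat u (Or.inl ⟨by linarith [hu.1], by linarith [hu.2]⟩)]
  · -- the cap over arc `2`
    refine hcap (Icc (R.mark 2 + s) (R.mark 3 - s)) (R.arc 2) (Q.arc 2)
      (fun u hu => ⟨u, ⟨by linarith [hu.1], by rw [n2]; linarith [hu.2]⟩, rfl⟩) ?_
    rintro _ ⟨u, hu, rfl⟩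
    rw [nQ2] at hu
    change u ∈ Icc (R.mark 2 + s) (R.mark 3 - s) at hu
    refine ⟨u, hu, ?_⟩
    show T.tube (1 + θ) u = T.tube (p u) u
    rw [hplat u (Or.inr ⟨by linarith [hu.1], by linarith [hu.2]⟩)]

/-- **Stub `stub_comparisonGeometryStrong` — comparison quads in sandwich position with the
all-points lateral margin.** For every conformal rectangle `R` and `ε₀ > 0` there is a lateral
margin `m > 0` such that for every plate margin `t > 0` there are a lower comparison quad `Q`
(w.r.t. the arcs `0, 2`) and an upper comparison quad `N` (w.r.t. the arcs `1, 3`, boundary close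
to the shifted loop), each with a room `r > 0`, whose whole `r`-fattenings are `m`-far from the
respective banned arcs; see `quadsStrong_exists_lowerQuad` and the module docstring.
[cite: BollobasRiordan2006, Ch. 7 Lemma 14 p. 184 and p. 186 (Fig. 14)] -/
theorem stub_comparisonGeometryStrong : Summit.CriticalPhenomena.CardyFormulaZ2.Cruxes.CoveringLeg.FiveArmNull.Sig.stub_comparisonGeometryStrong := by
  intro R ε₀ hε₀
  obtain ⟨R', hR'c, hR'b, hR'm, ha0, ha1, ha2, ha3⟩ := R.exists_shiftMarks
  obtain ⟨m₁, hm₁, hQ⟩ := quadsStrong_exists_lowerQuad R hε₀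
  obtain ⟨m₂, hm₂, hN⟩ := quadsStrong_exists_lowerQuad R' hε₀
  refine ⟨min m₁ m₂, lt_min hm₁ hm₂, fun t ht => ⟨?_, ?_⟩⟩
  · obtain ⟨Q, r, hr, c1, c2, c3, c4, c5, c6⟩ := hQ t ht
    exact ⟨Q, r, hr, c1, c2, c3, fun z hz => ⟨(min_le_left _ _).trans (c4 z hz).1,
      (min_le_left _ _).trans (c4 z hz).2⟩, c5, c6⟩
  · obtain ⟨N, r, hr, c1, c2, c3, c4, c5, c6⟩ := hN t ht
    rw [hR'c, ha0, ha1, ha2, ha3] at *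
    exact ⟨N, r, hr, fun u => (hR'b u) ▸ c1 u, fun i => (hR'm i) ▸ c2 i, c3,
      fun z hz => ⟨(min_le_right _ _).trans (c4 z hz).2, (min_le_right _ _).trans (c4 z hz).1⟩, c5, c6⟩

end Summit.CriticalPhenomena.CardyFormulaZ2.Cruxes.CoveringLeg.FiveArmNull
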